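import Literature.AnabelianGeometry.SemiGraphs.SplitsLemmas
import Literature.AnabelianGeometry.SemiGraphs.UniversalCoveringOver

/-!
# Quotients of coverings by groups of automorphisms ([SemiAnbd] §3, pp. 37–38)

For an object `Y` of `B^cov(𝒢)` and a subgroup `K ≤ Aut(Y)`, the quotient `Y/K`: its fibres are
the `K`-orbits of the fibres of `Y` (the automorphisms act fibrewise, commuting with the constituent
actions and the gluings), with the quotient morphism `Y ⟶ Y/K`.  Fibres stay countable with open
stabilisers; a finite covering splitting `Y` splits `Y/K`.  In [SemiAnbd] Prop. 3.6 (ii) (p. 38)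
the objects of `B^temp(π₁^temp(𝒢))` with one orbit are realised as quotients `𝒢_{∞,n}/K` of the
universal pro-coverings.
-/

namespace Literature.AnabelianGeometry.SemiGraphs

namespace ProfiniteSemiGraph

open CategoryTheory Topology

universe u

variable {𝒢 : ProfiniteSemiGraph.{u}} (Y : CovObj 𝒢) (K : Subgroup (Aut Y))

/-- The `K`-orbit relation on the vertex fibre `Y_v`. [cite: MochizukiSemiAnbd2006, Prop 3.6(ii) p.38] -/
def CovObj.quotSetoidV (v : 𝒢.graph.Vertex) : Setoid (Y.SV v).obj.V where
  r x x' := ∃ k : K, ((k : Aut Y).hom.fV v).hom.hom x = x'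
  iseqv :=
    { refl := fun x => ⟨1, rfl⟩
      symm := by
        rintro x x' ⟨k, rfl⟩
        refine ⟨k⁻¹, ?_⟩
        change (((k : Aut Y).hom ≫ ((k⁻¹ : K) : Aut Y).hom).fV v).hom.hom x = x
        rw [show (k : Aut Y).hom ≫ ((k⁻¹ : K) : Aut Y).hom = ((k⁻¹ * k : K) : Aut Y).hom from rfl,
          inv_mul_cancel]
        rfl
      trans := by
        rintro x x' x'' ⟨k, rfl⟩ ⟨k', rfl⟩
        exact ⟨k' * k, rfl⟩ }

/-- The `K`-orbit relation on the edge fibre `Y_e`. [cite: MochizukiSemiAnbd2006, Prop 3.6(ii) p.38] -/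
def CovObj.quotSetoidE (e : 𝒢.graph.Edge) : Setoid (Y.SE e).obj.V where
  r y y' := ∃ k : K, ((k : Aut Y).hom.fE e).hom.hom y = y'
  iseqv :=
    { refl := fun y => ⟨1, rfl⟩
      symm := by
        rintro y y' ⟨k, rfl⟩
        refine ⟨k⁻¹, ?_⟩
        change (((k : Aut Y).hom ≫ ((k⁻¹ : K) : Aut Y).hom).fE e).hom.hom y = y
        rw [show (k : Aut Y).hom ≫ ((k⁻¹ : K) : Aut Y).hom = ((k⁻¹ * k : K) : Aut Y).hom from rfl,
          inv_mul_cancel]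
        rfl
      trans := by
        rintro y y' y'' ⟨k, rfl⟩ ⟨k', rfl⟩
        exact ⟨k' * k, rfl⟩ }

/-- The vertex fibre of the quotient: `Y_v / K`. [cite: MochizukiSemiAnbd2006, Prop 3.6(ii) p.38] -/
def CovObj.QuotV (v : 𝒢.graph.Vertex) : Type u := Quotient (Y.quotSetoidV K v)

/-- The edge fibre of the quotient: `Y_e / K`. [cite: MochizukiSemiAnbd2006, Prop 3.6(ii) p.38] -/
def CovObj.QuotE (e : 𝒢.graph.Edge) : Type u := Quotient (Y.quotSetoidE K e)

/-- The `Π_v`-action descends to the quotient fibre. [cite: MochizukiSemiAnbd2006, Prop 3.6(ii) p.38] -/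
def CovObj.quotVAction (v : 𝒢.graph.Vertex) : Action (Type u) (𝒢.Gv v) where
  V := Y.QuotV K v
  ρ :=
    { toFun := fun g => TypeCat.ofHom (Quotient.map' (fun x => (Y.SV v).obj.ρ g x) (by
          rintro x x' ⟨k, rfl⟩
          exact ⟨k, CovHom.fV_ρ (k : Aut Y).hom v g x⟩))
      map_one' := by
        apply ConcreteCategory.hom_ext
        intro q
        induction q using Quotient.inductionOn with
        | h x =>
          change Quotient.mk _ ((Y.SV v).obj.ρ 1 x) = Quotient.mk _ x
          rw [map_one]; rfl
      map_mul' := fun g g' => by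
        apply ConcreteCategory.hom_ext
        intro q
        induction q using Quotient.inductionOn with
        | h x =>
          change Quotient.mk _ ((Y.SV v).obj.ρ (g * g') x) =
            Quotient.mk _ ((Y.SV v).obj.ρ g ((Y.SV v).obj.ρ g' x))
          rw [map_mul]; rfl }

/-- The `Π_e`-action descends to the quotient fibre. [cite: MochizukiSemiAnbd2006, Prop 3.6(ii) p.38] -/
def CovObj.quotEAction (e : 𝒢.graph.Edge) : Action (Type u) (𝒢.Ge e) where
  V := Y.QuotE K e
  ρ :=
    { toFun := fun g => TypeCat.ofHom (Quotient.map' (fun y => (Y.SE e).obj.ρ g y) (by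
          rintro y y' ⟨k, rfl⟩
          exact ⟨k, CovHom.fE_ρ (k : Aut Y).hom e g y⟩))
      map_one' := by
        apply ConcreteCategory.hom_ext
        intro q
        induction q using Quotient.inductionOn with
        | h y =>
          change Quotient.mk _ ((Y.SE e).obj.ρ 1 y) = Quotient.mk _ y
          rw [map_one]; rfl
      map_mul' := fun g g' => by
        apply ConcreteCategory.hom_ext
        intro q
        induction q using Quotient.inductionOn with
        | h y =>
          change Quotient.mk _ ((Y.SE e).obj.ρ (g * g') y) =
            Quotient.mk _ ((Y.SE e).obj.ρ g ((Y.SE e).obj.ρ g' y))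
          rw [map_mul]; rfl }

/-- A set of group elements which is a union of left cosets of an open stabiliser is open.
[folklore] -/
private theorem isOpen_of_stab {G : Type u} [Group G] [TopologicalSpace G] [IsTopologicalGroup G]
    {X : Type u} (ρ : G →* CategoryTheory.End X) (x : X) (hx : IsOpen {g : G | ρ g x = x})
    (S : Set G) (hS : ∀ g ∈ S, ∀ g', ρ g' x = ρ g x → g' ∈ S) : IsOpen S := by
  rw [isOpen_iff_mem_nhds]
  intro g hg
  have hcont : Continuous fun δ : G => g⁻¹ * δ := continuous_const.mul continuous_id
  refine Filter.mem_of_superset ((hx.preimage hcont).mem_nhds ?_) ?_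
  · change ρ (g⁻¹ * g) x = x
    rw [inv_mul_cancel, map_one]; rfl
  · intro g' hg'
    change ρ (g⁻¹ * g') x = x at hg'
    apply hS g hg g'
    have e : g' = g * (g⁻¹ * g') := by rw [mul_inv_cancel_left]
    rw [e, map_mul]
    change ρ g (ρ (g⁻¹ * g') x) = ρ g x
    rw [hg']

/-- The quotient vertex fibres are tempered `Π_v`-sets. [cite: MochizukiSemiAnbd2006, Prop 3.6(ii) p.38] -/
theorem CovObj.quotVAction_mem (v : 𝒢.graph.Vertex) : temperedAction (𝒢.Gv v) (Y.quotVAction K v) := by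
  haveI : Countable (Y.SV v).obj.V := (Y.SV v).property.1
  refine ⟨inferInstanceAs (Countable (Quotient (Y.quotSetoidV K v))), fun q => ?_⟩
  induction q using Quotient.inductionOn with
  | h x =>
    apply isOpen_of_stab (Y.SV v).obj.ρ x ((Y.SV v).property.2 x)
    intro g hg g' hg'
    change Quotient.mk _ ((Y.SV v).obj.ρ g' x) = Quotient.mk _ x
    rw [hg']
    exact hg

/-- The quotient edge fibres are tempered `Π_e`-sets. [cite: MochizukiSemiAnbd2006, Prop 3.6(ii) p.38] -/
theorem CovObj.quotEAction_mem (e : 𝒢.graph.Edge) : temperedAction (𝒢.Ge e) (Y.quotEAction K e) := by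
  haveI : Countable (Y.SE e).obj.V := (Y.SE e).property.1
  refine ⟨inferInstanceAs (Countable (Quotient (Y.quotSetoidE K e))), fun q => ?_⟩
  induction q using Quotient.inductionOn with
  | h y =>
    apply isOpen_of_stab (Y.SE e).obj.ρ y ((Y.SE e).property.2 y)
    intro g hg g' hg'
    change Quotient.mk _ ((Y.SE e).obj.ρ g' y) = Quotient.mk _ y
    rw [hg']
    exact hg

/-- The gluing bijection descends to the quotient. [cite: MochizukiSemiAnbd2006, Prop 3.6(ii) p.38] -/
noncomputable def CovObj.quotGlueEquiv (b : 𝒢.graph.Branch) (v : 𝒢.graph.Vertex)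
    (h : 𝒢.graph.abuts b = some v) : Y.QuotE K (𝒢.graph.edgeOf b) ≃ Y.QuotV K v where
  toFun := Quotient.map' (fun y => (Y.glue b v h).hom.hom.hom y) (by
    rintro y y' ⟨k, rfl⟩
    exact ⟨k, (CovHom.glue_fE (k : Aut Y).hom b v h y).symm⟩)
  invFun := Quotient.map' (fun x => (Y.glue b v h).inv.hom.hom x) (by
    rintro x x' ⟨k, rfl⟩
    refine ⟨k, ?_⟩
    apply Function.LeftInverse.injective (Y.glue_inv_hom b v h)
    rw [CovHom.glue_fE, Y.glue_hom_inv, Y.glue_hom_inv])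
  left_inv q := by
    induction q using Quotient.inductionOn with
    | h y => exact congrArg (Quotient.mk _) (Y.glue_inv_hom b v h y)
  right_inv q := by
    induction q using Quotient.inductionOn with
    | h x => exact congrArg (Quotient.mk _) (Y.glue_hom_inv b v h x)

/-- **The quotient covering `Y/K`.** [cite: MochizukiSemiAnbd2006, Prop 3.6(ii) p.38] -/
noncomputable def CovObj.quot : CovObj 𝒢 where
  SV v := ⟨Y.quotVAction K v, Y.quotVAction_mem K v⟩
  SE e := ⟨Y.quotEAction K e, Y.quotEAction_mem K e⟩
  glue b v h := (temperedAction (𝒢.Ge (𝒢.graph.edgeOf b))).isoMk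
    (Action.mkIso (Equiv.toIso (Y.quotGlueEquiv K b v h)) fun g => by
      apply ConcreteCategory.hom_ext
      intro q
      induction q using Quotient.inductionOn with
      | h y => exact congrArg (Quotient.mk _) (Y.glue_ρ b v h g y))

/-- **The quotient morphism `Y ⟶ Y/K`.** [cite: MochizukiSemiAnbd2006, Prop 3.6(ii) p.38] -/
noncomputable def CovObj.quotMk : Y ⟶ Y.quot K where
  fV v := ObjectProperty.homMk
    { hom := TypeCat.ofHom fun x : (Y.SV v).obj.V => (Quotient.mk _ x : Y.QuotV K v)
      comm := fun _ => rfl }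
  fE e := ObjectProperty.homMk
    { hom := TypeCat.ofHom fun y : (Y.SE e).obj.V => (Quotient.mk _ y : Y.QuotE K e)
      comm := fun _ => rfl }
  comm b v h := by
    apply ObjectProperty.hom_ext
    apply Action.Hom.ext
    apply ConcreteCategory.hom_ext
    intro y
    rfl

/-- The quotient morphism is surjective on vertex fibres. [cite: MochizukiSemiAnbd2006, Prop 3.6(ii) p.38] -/
theorem CovObj.quotMk_fV_surjective (v : 𝒢.graph.Vertex) :
    Function.Surjective ((Y.quotMk K).fV v).hom.hom := by
  intro q
  induction q using Quotient.inductionOn with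
  | h x => exact ⟨x, rfl⟩

/-- Two points have the same image in `Y/K` iff they are `K`-translates.
[cite: MochizukiSemiAnbd2006, Prop 3.6(ii) p.38] -/
theorem CovObj.quotMk_fV_eq_iff (v : 𝒢.graph.Vertex) (x x' : (Y.SV v).obj.V) :
    ((Y.quotMk K).fV v).hom.hom x = ((Y.quotMk K).fV v).hom.hom x' ↔
      ∃ k : K, ((k : Aut Y).hom.fV v).hom.hom x = x' :=
  Quotient.eq (r := Y.quotSetoidV K v)

/-- `K` acts trivially after the quotient: `k ≫ quotMk = quotMk`. [cite: MochizukiSemiAnbd2006, Prop 3.6(ii) p.38] -/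
theorem CovObj.aut_comp_quotMk (k : K) : (k : Aut Y).hom ≫ Y.quotMk K = Y.quotMk K := by
  refine CovHom.ext (funext fun v => ?_) (funext fun e => ?_)
  · apply ObjectProperty.hom_ext
    apply Action.Hom.ext
    apply ConcreteCategory.hom_ext
    intro x
    exact Quotient.sound (⟨k⁻¹, by
      change (((k : Aut Y).hom ≫ ((k⁻¹ : K) : Aut Y).hom).fV v).hom.hom x = x
      rw [show (k : Aut Y).hom ≫ ((k⁻¹ : K) : Aut Y).hom = ((k⁻¹ * k : K) : Aut Y).hom from rfl,
        inv_mul_cancel]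
      rfl⟩ : (Y.quotSetoidV K v) (((k : Aut Y).hom.fV v).hom.hom x) x)
  · apply ObjectProperty.hom_ext
    apply Action.Hom.ext
    apply ConcreteCategory.hom_ext
    intro y
    exact Quotient.sound (⟨k⁻¹, by
      change (((k : Aut Y).hom ≫ ((k⁻¹ : K) : Aut Y).hom).fE e).hom.hom y = y
      rw [show (k : Aut Y).hom ≫ ((k⁻¹ : K) : Aut Y).hom = ((k⁻¹ * k : K) : Aut Y).hom from rfl,
        inv_mul_cancel]
      rfl⟩ : (Y.quotSetoidE K e) (((k : Aut Y).hom.fE e).hom.hom y) y)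

/-- A covering splitting `Y` splits `Y/K`. [cite: MochizukiSemiAnbd2006, Prop 3.6(ii) p.38] -/
theorem CovObj.splits_quot {F : CovObj 𝒢} (hF : F.Splits Y) : F.Splits (Y.quot K) := by
  refine ⟨fun v x g hgx q => ?_, fun e x g hgx q => ?_⟩
  · induction q using Quotient.inductionOn with
    | h s => exact congrArg (Quotient.mk _) (hF.1 v x g hgx s)
  · induction q using Quotient.inductionOn with
    | h s => exact congrArg (Quotient.mk _) (hF.2 e x g hgx s)

end ProfiniteSemiGraph

end Literature.AnabelianGeometry.SemiGraphs
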